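import Literature.MathematicalPhysics.QuantumFieldTheory.HeppBound
import HarnessLib

/-!
# Affine position space computes the `φ⁴` period: Schnetz's (6d) `=` `π^{2(ℓ-1)}` × (6e) (named fact)

Topic `MathematicalPhysics/QuantumFieldTheory`; the follow-up explicitly deferred by
`GraphPeriod.lean` ("the `π^{2(ℓ-1)}` comparison of (6d) with (6e)"), vendored for route
`KontsevichZagierPeriods/PhiFourHepp`: it grounds the VALUE side of the cruxes
`Summit.KontsevichZagierPeriods.KontsevichZagierPeriods.Theses.PhiFourHepp.PositionIsParametric`
(stmt-KontsevichZagierPeriods-12287) and `.PositionK4` (stmt-12290) — by soundness of the KZ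
calculus (`KZ.Equivalent.value_eq_holds`) the two representations those items connect must have
equal values, and this is the printed theorem saying they do (the items themselves ask for a MOVE
CHAIN, which is more).

Source read (held `paper:arxiv-0801.2856`, pp. 7–9): O. Schnetz, *Quantum periods: a census of
`φ⁴`-transcendentals*, Commun. Number Theory Phys. 4 (2010) 1–47 = arXiv:0801.2856,
**Definition and Theorem 7** (p. 7): "Let `Γ` be a 4-regular graph with loop order `ℓ`. If `Γ` is
completed primitive then the following equations define the same number `P_Γ`, otherwise all
equations are ill-defined." Among the six: (6d) *Affine position space* (p. 8): "Choose three
vertices in `Γ` with labels `∞`, `0`, and `1`. Use standard position space Feynman rules for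
`Γ - ∞`, set `x_0 = 0`, and set the position vector `x_1` to any unit-vector `1` in `ℝ⁴` to obtain
`P_Γ = π^{-2(ℓ-1)} ∫_{ℝ^{4(ℓ-1)}} d⁴x_2 ⋯ d⁴x_ℓ / Π_1^{2ℓ} |x_i - x_j|² |_{x_0 → 0, x_1 → 1}`";
(6e) *Parametric space*: "`P_Γ = ∫_Δ Ω(α)/Ψ_{Γ-∞}(α)²`" (`Δ = {α_i > 0}`); proof, fifth step
(p. 8): "the period in Eq. (6d) cannot depend on the choices of `0` and `1`"; Prop. 6 (p. 7):
"`Γ - v` is primitive if and only if `Γ` is completed primitive".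

## Rendering

The decompletion `E = Γ - ∞` is an edge list with `2k + 2` edges on the vertices `Fin (k + 2)`
(`2ℓ` edges on `ℓ + 1` vertices, `ℓ = k + 1`, Schnetz Lemma 5), so `4(ℓ - 1) = 4k` free real
coordinates and `π^{2(ℓ-1)} = π^{2k}`. "`Γ` 4-regular completed primitive" ⟺ (Prop. 6 + Lemma 5)
`E` has all degrees `≤ 4` (`IsPhiFour`; the completion vertex `∞` then receives exactly the
deficiency `4(k+2) - 2(2k+2) = 4`), is connected (`IsConnectedEdgeList`) and primitive divergent
(`IsPrimitiveDivergent`, Schnetz Def.-Thm. 1 = Brown Def. 4). The left side of (6d) is the Lebesgue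
(= Bochner, `volume`) integral over `ℝ^{4k}` of the tree's `positionIntegrand E` (vertex `0 ↦ 0`,
vertex `1 ↦ e₁`, `GraphPeriod.lean`); the right side (6e), read in the affine chart `α_N = 1`
(Schnetz p. 5), is the tree's `graphPeriod E = ∫_{x ∈ (0,∞)^{2k+1}} dx/Ψ_E(x,1)²`
(`HeppBound.lean`). "Define the same number … otherwise ill-defined" is rendered by ALSO recording
absolute convergence of the position-space integral (`Integrable`), the part of the theorem a user
needs to build a `KZ.IntegralRep` from `positionIntegrand`.

## References

* [Schnetz2010] O. Schnetz, CNTP 4 (2010) = arXiv:0801.2856, Def.-Thm. 7 ((6d), (6e)), Prop. 6,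
  Lemma 5, Ex. 2.2 (`P₁ = 1`), eq. after (6f) (`P₃ = 6ζ(3)`).
* [Brown2009FeynmanPeriods] F. Brown, arXiv:0910.0114, Def. 4 (primitive divergent).
-/

noncomputable section

open MeasureTheory

namespace Literature.MathematicalPhysics.QuantumFieldTheory

/-- **Schnetz 2010, Definition-Theorem 7, (6d) = (6e): affine position space computes the
period.** For a `φ⁴` edge list `E` (all degrees `≤ 4`) with `2k + 2` edges on `k + 2` vertices
that is connected and primitive divergent — i.e. `E = Γ - ∞` for a 4-regular completed primitive
`Γ` of loop order `ℓ = k + 1` (Schnetz Prop. 6) — the affine position-space integral with vertex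
`0` at the origin and vertex `1` at the unit vector `e₁` converges absolutely and
`∫_{ℝ^{4k}} Π_e |x_{s(e)} - x_{t(e)}|^{-2} d^{4k}x = π^{2k} · P(E)`, where
`P(E) = ∫_{x>0} dx/Ψ_E(x,1)²` is the parametric period (6e) (`graphPeriod`). Printed form:
"`P_Γ = π^{-2(ℓ-1)} ∫_{ℝ^{4(ℓ-1)}} d⁴x_2⋯d⁴x_ℓ / Π|x_i - x_j|² |_{x_0→0, x_1→1}`" and
"`P_Γ = ∫_Δ Ω(α)/Ψ_{Γ-∞}(α)²`" "define the same number". Grounds the value side of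
`Summit.KontsevichZagierPeriods.KontsevichZagierPeriods.Theses.PhiFourHepp.PositionIsParametric` and
`.PositionK4`. [cite: Schnetz2010, Def.-Thm. 7 ((6d) = (6e)) with Prop. 6] -/
def Schnetz2010_position_eq_parametric : Prop :=
  ∀ (k : ℕ) (E : Fin (2 * k + 2) → Fin (k + 2) × Fin (k + 2)),
    IsPhiFour E → IsConnectedEdgeList E → IsPrimitiveDivergent E →
      Integrable (positionIntegrand E) ∧
        ∫ y, positionIntegrand E y = Real.pi ^ (2 * k) * graphPeriod E

namespace Schnetz2010_position_eq_parametric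

/-- The equation alone. [cite: Schnetz2010, Def.-Thm. 7 ((6d) = (6e))] -/
theorem integral_eq (h : Schnetz2010_position_eq_parametric) {k : ℕ}
    {E : Fin (2 * k + 2) → Fin (k + 2) × Fin (k + 2)} (h₄ : IsPhiFour E)
    (hc : IsConnectedEdgeList E) (hp : IsPrimitiveDivergent E) :
    ∫ y, positionIntegrand E y = Real.pi ^ (2 * k) * graphPeriod E :=
  (h k E h₄ hc hp).2

/-- Absolute convergence of the affine position-space integral of a `φ⁴` connected
primitive-divergent edge list ("define the same number … otherwise ill-defined").
[cite: Schnetz2010, Def.-Thm. 7 (6d)] -/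
theorem integrable (h : Schnetz2010_position_eq_parametric) {k : ℕ}
    {E : Fin (2 * k + 2) → Fin (k + 2) × Fin (k + 2)} (h₄ : IsPhiFour E)
    (hc : IsConnectedEdgeList E) (hp : IsPrimitiveDivergent E) :
    Integrable (positionIntegrand E) :=
  (h k E h₄ hc hp).1

/-- The smallest live instance, `k = 2`, `E = K₄ = W₃` (decompletion of `K₅ = P₃`): the
position-space integral over `ℝ⁸` equals `π⁴ · P(K₄)` (and `P(K₄) = P₃ = 6ζ(3)`, Schnetz 2010,
eq. before Def. 9 — not asserted here). Pure instantiation, for item `PositionK4`.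
[cite: Schnetz2010, Def.-Thm. 7 ((6d) = (6e)), example P₃ (p. 9)] -/
theorem k4 (h : Schnetz2010_position_eq_parametric)
    (h₄ : IsPhiFour (![(0, 1), (0, 2), (0, 3), (1, 2), (1, 3), (2, 3)] : Fin 6 → Fin 4 × Fin 4))
    (hc : IsConnectedEdgeList (![(0, 1), (0, 2), (0, 3), (1, 2), (1, 3), (2, 3)] : Fin 6 → Fin 4 × Fin 4))
    (hp : IsPrimitiveDivergent (![(0, 1), (0, 2), (0, 3), (1, 2), (1, 3), (2, 3)] : Fin 6 → Fin 4 × Fin 4)) :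
    ∫ y, positionIntegrand (![(0, 1), (0, 2), (0, 3), (1, 2), (1, 3), (2, 3)] : Fin 6 → Fin 4 × Fin 4) y =
      Real.pi ^ 4 * graphPeriod (![(0, 1), (0, 2), (0, 3), (1, 2), (1, 3), (2, 3)] : Fin 6 → Fin 4 × Fin 4) :=
  (h 2 _ h₄ hc hp).2

end Schnetz2010_position_eq_parametric

end Literature.MathematicalPhysics.QuantumFieldTheory
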